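import Summits.CriticalPhenomena.CardyFormulaZ2.Theorems.CardyComplexConeParafermionToSLESixFamiliesDiamondDefs
import HarnessLib

/-!
# Line `potential-darboux-picard-diamond`, stub S4′ (`stub_identifyPotentialPh`): monotone reparametrisation between two boundary arguments

Helper file of the stub `stub_identifyPotentialPh` of crux `ParafermionToSLESixFamilies` (stmt-CriticalPhenomena-11389).
Step (iv) of the identification compares two counter-clockwise parametrisations of the boundary of the (convex) diamond
through their continuous arguments about the centre: the boundary correspondence `t ↦ Φ_R(e^{it})` of a Riemann map
(argument `θ_R`, continuous, non-decreasing, total increase `2π` — `boundaryArg_of_injOn_sphere` + `TraceWindingNonneg`)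
and the explicit boundary loop `ℓ` (argument `Θ`, continuous and STRICTLY increasing, `Θ (s + 2π) = Θ s + 2π` —
`monotoneArg_of_pieces`). Matching arguments gives the reparametrisation `λ` with `Θ ∘ λ = θ_R`, hence
`ℓ ∘ λ = Φ_R ∘ e^{i·}` (one frontier point per ray). This file proves the real-variable statement
(`exists_monotone_reparam`, registered helper of the crux item): `λ` exists, is continuous and non-decreasing on
`[0, 2π]` with values in `[0, 4π]`, `λ 0 = s₀`, `λ (2π) = s₀ + 2π`. The inverse of the strictly increasing continuous
`Θ` on the compact interval is continuous as an order isomorphism of intervals (`OrderIso.continuous`).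
-/

noncomputable section

namespace Summit.CriticalPhenomena.CardyFormulaZ2.Cruxes.ParafermionToSLESixFamilies.PotentialDarbouxPicardDiamond

open scoped Topology
open Filter Set

/-- **Monotone reparametrisation between two arguments.** Let `Θ` be continuous and strictly increasing on
`[0, A]` and `θ` continuous and non-decreasing on `[0, B]` with values in `[Θ 0, Θ A]`. Then `θ = Θ ∘ λ` on `[0, B]`
for a `λ` continuous and non-decreasing on `[0, B]` with values in `[0, A]`; moreover `λ b = s` whenever `θ b = Θ s`,
`s ∈ [0, A]`. -/
theorem exists_monotone_reparam : ∀ (Θ θ : ℝ → ℝ) (A B : ℝ), 0 ≤ A → 0 ≤ B → ContinuousOn Θ (Set.Icc 0 A) → StrictMonoOn Θ (Set.Icc 0 A) → ContinuousOn θ (Set.Icc 0 B) → MonotoneOn θ (Set.Icc 0 B) → (∀ b ∈ Set.Icc 0 B, θ b ∈ Set.Icc (Θ 0) (Θ A)) → ∃ lam : ℝ → ℝ, ContinuousOn lam (Set.Icc 0 B) ∧ MonotoneOn lam (Set.Icc 0 B) ∧ (∀ b ∈ Set.Icc 0 B, lam b ∈ Set.Icc 0 A ∧ Θ (lam b) =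 θ b) ∧ (∀ b ∈ Set.Icc 0 B, ∀ s ∈ Set.Icc 0 A, θ b = Θ s → lam b = s) := by
  intro Θ θ A B hA hB hΘc hΘm hθc hθm hrange
  classical
  -- the image of `[0, A]` under `Θ` is `[Θ 0, Θ A]`
  have himage : Θ '' Icc 0 A = Icc (Θ 0) (Θ A) := by
    apply Subset.antisymm
    · rintro _ ⟨s, hs, rfl⟩
      exact ⟨hΘm.monotoneOn (left_mem_Icc.2 hA) hs hs.1, hΘm.monotoneOn hs (right_mem_Icc.2 hA) hs.2⟩
    · exact intermediate_value_Icc hA hΘc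
  -- the order isomorphism `[0, A] ≃o [Θ 0, Θ A]` and its continuous inverse
  set e : Icc (0:ℝ) A ≃o Icc (Θ 0) (Θ A) := (hΘm.orderIso Θ (Icc 0 A)).trans (OrderIso.setCongr _ _ himage)
    with he
  have he_apply : ∀ s : Icc (0:ℝ) A, (e s : ℝ) = Θ s := fun s => rfl
  have hsymm_apply : ∀ y : Icc (Θ 0) (Θ A), Θ (e.symm y : ℝ) = y := fun y => by
    have := he_apply (e.symm y)
    rw [OrderIso.apply_symm_apply] at this
    exact this.symm
  have hcont_symm : Continuous e.symm := e.symm.continuous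
  -- the reparametrisation
  set lam : ℝ → ℝ := fun b => if h : b ∈ Icc 0 B then (e.symm ⟨θ b, hrange b h⟩ : ℝ) else 0 with hlam
  have hlam_mem : ∀ b (h : b ∈ Icc 0 B), lam b = (e.symm ⟨θ b, hrange b h⟩ : ℝ) := fun b h => by
    simp only [hlam, dif_pos h]
  have hval : ∀ b ∈ Icc 0 B, lam b ∈ Icc 0 A ∧ Θ (lam b) = θ b := by
    intro b hb
    rw [hlam_mem b hb]
    exact ⟨(e.symm ⟨θ b, hrange b hb⟩).2, hsymm_apply _⟩
  have huniq : ∀ b ∈ Icc 0 B, ∀ s ∈ Icc 0 A, θ b = Θ s → lam b = s := by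
    intro b hb s hs hbs
    have h1 := hval b hb
    exact hΘm.injOn h1.1 hs (h1.2.trans hbs)
  refine ⟨lam, ?_, ?_, hval, huniq⟩
  · -- continuity on `[0, B]`
    rw [continuousOn_iff_continuous_restrict]
    have hθr : Continuous fun b : Icc (0:ℝ) B => (⟨θ b, hrange b b.2⟩ : Icc (Θ 0) (Θ A)) :=
      (hθc.restrict).subtype_mk _
    have hcomp : Continuous fun b : Icc (0:ℝ) B => ((e.symm ⟨θ b, hrange b b.2⟩ : Icc (0:ℝ) A) : ℝ) :=
      continuous_subtype_val.comp (hcont_symm.comp hθr)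
    convert hcomp using 1
    ext b
    exact hlam_mem b b.2
  · -- monotonicity on `[0, B]`
    intro b hb b' hb' hbb'
    rw [hlam_mem b hb, hlam_mem b' hb']
    have : (⟨θ b, hrange b hb⟩ : Icc (Θ 0) (Θ A)) ≤ ⟨θ b', hrange b' hb'⟩ := hθm hb hb' hbb'
    exact_mod_cast e.symm.monotone this

end Summit.CriticalPhenomena.CardyFormulaZ2.Cruxes.ParafermionToSLESixFamilies.PotentialDarbouxPicardDiamond

end
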